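import Mathlib
import Summits.Ventures.LatticeQCDFlow.TrivializingMaps.GradedSupBounds
import HarnessLib

/-!
# Summing Lüscher's flow-action series, IV-a: the graded terms as continuous multilinear forms

HONEST FRAMING: exact (Metropolis-corrected) sampling algorithms for lattice gauge theory; figures
of merit are autocorrelation/cost numbers at stated couplings and volumes; no continuum-physics claim.
Bookkeeping about Lüscher's construction for the SU(n) Wilson plaquette action on a FINITE periodic
lattice (M. Lüscher, CMP 293 (2010) 899–919 [Luscher2010Trivializing], §4.3–§4.4: every order of the
flow-action series is "a polynomial in the link variables").

Purpose.  The flow `Φ_t` of the gradient generator `Z_t = -∂S̃_t` (Lüscher (4.4)) is built (§3.1,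
`FlowGlobalExistence`) from a generator that is `C¹` JOINTLY in `(t, U)` on the ambient space, and the tree's
unconditional §4.1 (`isTrivializingMap_of_flowEquation'`) wants the flow action `(t, W) ↦ S̃_t(W)` to be
`C^∞` there.  The companion file `AnalyticFlowAction.lean` gets this regularity for the summed series
`∑_k t^k β^{k+1} S̃^{(k)}` from a POWER-SERIES structure in the phase-space variable `q = (t, W)`; this file
provides the algebra: on the coordinate phase space `ℝ × (ℂ^{n×n})^E` (sup norms; the venture's Frobenius
space `M_n(ℂ)^E` is embedded entrywise in the companion file),

* §1 the time coordinate and the (polarised) matrix entries are continuous real-linear functionals of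
  norm `≤ 1` (`timeCLM`, `entryCLM`);
* §2 a slot monomial `t^k ∏_s (Ŵ(lnk s))_{I s, J s}` is the diagonal value of the continuous multilinear
  form `mkPiAlgebra ∘ (functionals)` on `Fin k ⊕ σ` copies of the phase space, of norm `≤ 1` (`monom`);
  a coefficient function `Re ∑ a_{IJ} R_σ(W)_{IJ}` likewise, of norm `≤ ∑ |a_{IJ}|` (`coeffForm`);
* §3 a whole generation `G` of the Casimir-graded series (`GradedData`) at coupling `β` and order `k` is
  the diagonal value of ONE form `Gen.cmm G k β` with `cmm (q,…,q) = t^k β^{k+1} G.func(W)` and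
  `‖cmm‖ ≤ |β|^{k+1} (n^{|σ|})² ∑ᵢ νᵢ`, and `∑ᵢ νᵢ ≤ (n/4)^{-1/2} ∑ₑ N_G(e)` (`Gen.sum_nu_le`).

Authored by the pub-lqcd lean-2 seat (cell lqcd-flow, FANOUT row 31 GEN-4). Tags: [ours] = venture work.
-/

noncomputable section

namespace Summit.Ventures.LatticeQCDFlow.TrivializingMaps

open scoped ComplexConjugate Matrix Matrix.Norms.Frobenius InnerProductSpace ContDiff NNReal ENNReal Topology
open Literature.MathematicalPhysics.QuantumFieldTheory
open Literature.MathematicalPhysics.QuantumFieldTheory.Luscher2010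
open SlotRepresentation SlotCoefficient SlotHilbert RankOne Vertex

namespace AnalyticSeries

variable {d L n : ℕ} [NeZero L]

/-! ## §1. The coordinate phase space and its coordinate functionals -/

/-- The **coordinate phase space** `ℝ × (ℂ^{n×n})^E` (sup norms throughout): time and link-matrix entries.
The operator norms of multilinear forms are computed here; the venture's ambient space `M_n(ℂ)^E`
(Frobenius norms) is embedded entrywise in §7. [ours] -/
abbrev PhaseP (d L n : ℕ) : Type := ℝ × (Edge d L → Fin n → Fin n → ℂ)

/-- Coordinates back to ambient configurations: `V ↦ (e ↦ Matrix.of (V e))`. [ours] -/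
def toAmb (V : Edge d L → Fin n → Fin n → ℂ) : AmbConfig d L n := fun e => Matrix.of (V e)

omit [NeZero L] in
/-- Entries of `toAmb`. [ours] -/
@[simp] theorem toAmb_apply (V : Edge d L → Fin n → Fin n → ℂ) (e : Edge d L) (i j : Fin n) :
    toAmb V e i j = V e i j := rfl

/-- **The entry functional** `q = (t, V) ↦ V̂(e)_{ij}` (`V̂ = V` or `V̄` according to the polarity): a
real-linear continuous functional of norm `≤ 1`. [ours] -/
def entryCLM (e : Edge d L) (b : Bool) (i j : Fin n) : PhaseP d L n →L[ℝ] ℂ :=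
  LinearMap.mkContinuous
    { toFun := fun q => polM b (toAmb q.2 e) i j
      map_add' := fun p q => by
        cases b <;> simp [toAmb, Matrix.map_apply]
      map_smul' := fun r p => by
        cases b <;> simp [toAmb, Matrix.map_apply, Complex.real_smul] }
    1 fun q => by
      rw [one_mul]
      have h1 : ‖polM b (toAmb q.2 e) i j‖ = ‖q.2 e i j‖ := by
        cases b
        · simp [toAmb, Matrix.map_apply]
        · simp [toAmb]
      show ‖polM b (toAmb q.2 e) i j‖ ≤ ‖q‖
      rw [h1]
      exact (norm_le_pi_norm (q.2 e i) j).trans ((norm_le_pi_norm (q.2 e) i).trans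
        ((norm_le_pi_norm q.2 e).trans (norm_snd_le q)))

/-- Value of the entry functional. [ours] -/
@[simp] theorem entryCLM_apply (e : Edge d L) (b : Bool) (i j : Fin n) (q : PhaseP d L n) :
    entryCLM e b i j q = polM b (toAmb q.2 e) i j := rfl

/-- `‖entry functional‖ ≤ 1`. [ours] -/
theorem norm_entryCLM_le (e : Edge d L) (b : Bool) (i j : Fin n) :
    ‖entryCLM (d := d) (L := L) e b i j‖ ≤ 1 :=
  LinearMap.mkContinuous_norm_le _ zero_le_one _

/-- **The time functional** `q = (t, V) ↦ t` (as a complex number), of norm `≤ 1`. [ours] -/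
def timeCLM : PhaseP d L n →L[ℝ] ℂ :=
  Complex.ofRealCLM.comp (ContinuousLinearMap.fst ℝ ℝ (Edge d L → Fin n → Fin n → ℂ))

omit [NeZero L] in
/-- Value of the time functional. [ours] -/
@[simp] theorem timeCLM_apply (q : PhaseP d L n) : timeCLM q = (q.1 : ℂ) := rfl

/-- `‖time functional‖ ≤ 1`. [ours] -/
theorem norm_timeCLM_le : ‖(timeCLM : PhaseP d L n →L[ℝ] ℂ)‖ ≤ 1 := by
  refine ContinuousLinearMap.opNorm_le_bound _ zero_le_one fun q => ?_
  rw [timeCLM_apply, Complex.norm_real, one_mul]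
  exact norm_fst_le q

/-! ## §2. Slot monomials and coefficient functions as continuous multilinear forms -/

section Slot

variable {σ : Type} [Fintype σ] [DecidableEq σ] (lnk : σ → Edge d L) (pol : σ → Bool)

/-- The functionals of a slot monomial of order `k`: `k` copies of the time functional and, for each
slot `s`, the entry functional of its link, polarity and indices `(I s, J s)`. [ours] -/
def slotFun (k : ℕ) (I J : σ → Fin n) : Fin k ⊕ σ → (PhaseP d L n →L[ℝ] ℂ) :=
  Sum.elim (fun _ => timeCLM) fun s => entryCLM (lnk s) (pol s) (I s) (J s)

/-- **The slot monomial** `(q_j)_{j ∈ Fin k ⊕ σ} ↦ ∏_{j<k} t_j · ∏_s (V̂_s(lnk s))_{I s, J s}`, a continuous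
multilinear form on `Fin k ⊕ σ` copies of the phase space. [ours] -/
def monom (k : ℕ) (I J : σ → Fin n) : ContinuousMultilinearMap ℝ (fun _ : Fin k ⊕ σ => PhaseP d L n) ℂ :=
  (ContinuousMultilinearMap.mkPiAlgebra ℝ (Fin k ⊕ σ) ℂ).compContinuousLinearMap (slotFun lnk pol k I J)

omit [DecidableEq σ] in
/-- On the diagonal the slot monomial is `t^k · R_σ(W)_{IJ}`. [ours] -/
theorem monom_apply_const (k : ℕ) (I J : σ → Fin n) (q : PhaseP d L n) :
    monom lnk pol k I J (fun _ => q) = (q.1 : ℂ) ^ k * slotRep lnk pol (toAmb q.2) I J := by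
  rw [monom, ContinuousMultilinearMap.compContinuousLinearMap_apply,
    ContinuousMultilinearMap.mkPiAlgebra_apply, Fintype.prod_sum_type]
  simp only [slotFun, Sum.elim_inl, Sum.elim_inr, timeCLM_apply, entryCLM_apply, Finset.prod_const,
    Finset.card_univ, Fintype.card_fin, slotRep, kronPi_apply]

omit [DecidableEq σ] in
/-- `‖slot monomial‖ ≤ 1`. [ours] -/
theorem norm_monom_le (k : ℕ) (I J : σ → Fin n) : ‖monom (d := d) (L := L) lnk pol k I J‖ ≤ 1 := by
  refine (ContinuousMultilinearMap.norm_compContinuousLinearMap_le _ _).trans ?_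
  have h1 : ‖ContinuousMultilinearMap.mkPiAlgebra ℝ (Fin k ⊕ σ) ℂ‖ ≤ 1 := by
    rw [ContinuousMultilinearMap.norm_mkPiAlgebra]
  have h2 : ∏ j, ‖slotFun (d := d) (L := L) lnk pol k I J j‖ ≤ 1 := by
    refine Finset.prod_le_one (fun j _ => norm_nonneg _) fun j _ => ?_
    rcases j with j | s
    · exact norm_timeCLM_le
    · exact norm_entryCLM_le _ _ _ _
  calc _ ≤ (1 : ℝ) * 1 := mul_le_mul h1 h2 (Finset.prod_nonneg fun j _ => norm_nonneg _) zero_le_one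
    _ = 1 := one_mul 1

/-- **The coefficient form** of a kernel `a`: `Re ∑_{I,J} a_{IJ} · monom_{IJ}`. [ours] -/
def coeffForm (a : Kernel σ n) (k : ℕ) : ContinuousMultilinearMap ℝ (fun _ : Fin k ⊕ σ => PhaseP d L n) ℝ :=
  Complex.reCLM.compContinuousMultilinearMap (∑ I, ∑ J, a I J • monom lnk pol k I J)

/-- On the diagonal: `coeffForm a k (q, …, q) = t^k · coeff a (W)`. [ours] -/
theorem coeffForm_apply_const (a : Kernel σ n) (k : ℕ) (q : PhaseP d L n) :
    coeffForm lnk pol a k (fun _ => q) = q.1 ^ k * coeff lnk pol a (toAmb q.2) := by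
  rw [coeffForm, ContinuousLinearMap.compContinuousMultilinearMap_coe, Function.comp_apply]
  simp only [sum_apply, smul_apply, monom_apply_const, smul_eq_mul]
  rw [coeff, coeffC]
  have h : ∑ I, ∑ J, a I J * ((q.1 : ℂ) ^ k * slotRep lnk pol (toAmb q.2) I J) =
      ((q.1 ^ k : ℝ) : ℂ) * ∑ I, ∑ J, a I J * slotRep lnk pol (toAmb q.2) I J := by
    rw [Complex.ofReal_pow, Finset.mul_sum]
    refine Finset.sum_congr rfl fun I _ => ?_
    rw [Finset.mul_sum]
    exact Finset.sum_congr rfl fun J _ => by ring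
  rw [h]
  show (((q.1 ^ k : ℝ) : ℂ) * ∑ I, ∑ J, a I J * slotRep lnk pol (toAmb q.2) I J).re = _
  rw [Complex.re_ofReal_mul]

/-- `‖coeffForm a‖ ≤ ∑_{I,J} |a_{IJ}|`. [ours] -/
theorem norm_coeffForm_le (a : Kernel σ n) (k : ℕ) :
    ‖coeffForm (d := d) (L := L) lnk pol a k‖ ≤ ∑ I, ∑ J, ‖a I J‖ := by
  refine (ContinuousLinearMap.norm_compContinuousMultilinearMap_le _ _).trans ?_
  rw [Complex.reCLM_norm, one_mul]
  refine (norm_sum_le _ _).trans (Finset.sum_le_sum fun I _ => ?_)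
  refine (norm_sum_le _ _).trans (Finset.sum_le_sum fun J _ => ?_)
  rw [norm_smul]
  exact (mul_le_mul_of_nonneg_left (norm_monom_le lnk pol k I J) (norm_nonneg _)).trans (le_of_eq (mul_one _))

omit [NeZero L] in
/-- The `ℓ¹` mass of a scaled rank-one kernel: `∑_{I,J} |z conj(y_I) x_J| ≤ |z| · (n^{|σ|})² ‖x‖ ‖y‖`
(each coordinate is bounded by the Hilbert norm; there are `n^{|σ|}` multi-indices). [ours] -/
theorem sum_norm_smul_rank1_le (z : ℂ) (x y : SlotSpace σ n) :
    ∑ I, ∑ J, ‖(z • rank1 x y) I J‖ ≤ ‖z‖ * ((n : ℝ) ^ Fintype.card σ) ^ 2 * (‖x‖ * ‖y‖) := by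
  have hy : ∀ I, ‖WithLp.ofLp y I‖ ≤ ‖y‖ := fun I => PiLp.norm_apply_le y I
  have hx : ∀ J, ‖WithLp.ofLp x J‖ ≤ ‖x‖ := fun J => PiLp.norm_apply_le x J
  have hcard : (Fintype.card (σ → Fin n) : ℝ) = (n : ℝ) ^ Fintype.card σ := by
    rw [Fintype.card_fun, Fintype.card_fin]; push_cast; ring
  have hterm : ∀ I J, ‖(z • rank1 x y) I J‖ ≤ ‖z‖ * (‖x‖ * ‖y‖) := by
    intro I J
    rw [Pi.smul_apply, Pi.smul_apply, smul_eq_mul, rank1_apply, norm_mul, norm_mul, Complex.norm_conj]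
    refine mul_le_mul_of_nonneg_left ?_ (norm_nonneg _)
    rw [mul_comm]
    exact mul_le_mul (hx J) (hy I) (norm_nonneg _) (norm_nonneg _)
  calc ∑ I, ∑ J, ‖(z • rank1 x y) I J‖ ≤ ∑ _I : σ → Fin n, ∑ _J : σ → Fin n, ‖z‖ * (‖x‖ * ‖y‖) :=
        Finset.sum_le_sum fun I _ => Finset.sum_le_sum fun J _ => hterm I J
    _ = ‖z‖ * ((n : ℝ) ^ Fintype.card σ) ^ 2 * (‖x‖ * ‖y‖) := by
        rw [Finset.sum_const, Finset.sum_const, Finset.card_univ, smul_smul, nsmul_eq_mul, Nat.cast_mul, hcard]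
        ring

end Slot

/-! ## §3. A generation as one multilinear form -/

namespace Gen

open GradedSeries

variable {B : SuBasis n} {σ : Type} [Fintype σ] [DecidableEq σ] (G : GradedSeries.Gen (d := d) (L := L) B σ)

/-- **The multilinear form of a generation at coupling `β` and order `k`**:
`∑ᵢ coeffForm((β^{k+1} zᵢ) • |xᵢ⟩⟨yᵢ|)`; its diagonal value at `q = (t, V)` is `t^k β^{k+1} G.func(W)`.
[ours] -/
def cmm (k : ℕ) (β : ℝ) : ContinuousMultilinearMap ℝ (fun _ : Fin k ⊕ σ => PhaseP d L n) ℝ :=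
  ∑ i, coeffForm (G.lnk i) (G.pol i) ((((β ^ (k + 1) : ℝ) : ℂ) * G.z i) • rank1 (G.x i) (G.y i)) k

/-- Diagonal value: `cmm G k β (q, …, q) = t^k · (β^{k+1} · G.func W)`. [ours] -/
theorem cmm_apply_const (k : ℕ) (β : ℝ) (q : PhaseP d L n) :
    cmm G k β (fun _ => q) = q.1 ^ k * (β ^ (k + 1) * G.func (toAmb q.2)) := by
  unfold cmm
  simp only [sum_apply, coeffForm_apply_const]
  rw [← Finset.mul_sum]
  congr 1
  rw [GradedSeries.Gen.func, Finset.mul_sum]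
  exact Finset.sum_congr rfl fun i _ =>
    termF_real_mul_left (G.lnk i) (G.pol i) (β ^ (k + 1)) (G.z i) (G.x i) (G.y i) (toAmb q.2)

/-- Norm: `‖cmm G k β‖ ≤ |β|^{k+1} (n^{|σ|})² ∑ᵢ νᵢ`. [ours] -/
theorem norm_cmm_le (k : ℕ) (β : ℝ) :
    ‖cmm G k β‖ ≤ |β| ^ (k + 1) * ((n : ℝ) ^ Fintype.card σ) ^ 2 * ∑ i, G.nu i := by
  rw [cmm]
  refine (norm_sum_le _ _).trans ?_
  rw [Finset.mul_sum]
  refine Finset.sum_le_sum fun i _ => ?_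
  refine (norm_coeffForm_le _ _ _ k).trans ((sum_norm_smul_rank1_le _ _ _).trans (le_of_eq ?_))
  rw [norm_mul, Complex.norm_real, Real.norm_eq_abs, abs_pow, GradedSeries.Gen.nu]
  ring

/-- The total mass of a generation whose dead data carry no coefficient is dominated by the link
masses: `∑ᵢ νᵢ ≤ (n/4)^{-1/2} ∑ₑ N_G(e)`. [ours] -/
theorem sum_nu_le (hn : n ≠ 0) (hz : ∀ i, G.cm i = 0 → G.z i = 0) :
    ∑ i, G.nu i ≤ (Real.sqrt ((n : ℝ) / 4))⁻¹ * ∑ e, G.mass e := by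
  have hγ : 0 < Real.sqrt ((n : ℝ) / 4) :=
    Real.sqrt_pos.2 (div_pos (Nat.cast_pos.2 (Nat.pos_of_ne_zero hn)) four_pos)
  have h1 : ∑ i, G.nu i = ∑ i ∈ G.live, G.nu i := by
    unfold GradedSeries.Gen.live
    rw [Finset.sum_filter_of_ne]
    intro i _ hi hc
    apply hi
    unfold GradedSeries.Gen.nu; rw [hz i hc, norm_zero, zero_mul]
  have h2 : ∑ i ∈ G.live, G.nu i ≤ (Real.sqrt ((n : ℝ) / 4))⁻¹ * ∑ i ∈ G.live, ∑ e, G.wt i e * G.nu i := by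
    rw [Finset.mul_sum]
    refine Finset.sum_le_sum fun i hi => ?_
    rw [← Finset.sum_mul, ← mul_assoc]
    have h := G.sqrt_quarter_le_sum_wt hi
    have : 1 ≤ (Real.sqrt ((n : ℝ) / 4))⁻¹ * ∑ e, G.wt i e := by
      rw [inv_mul_eq_div, le_div_iff₀ hγ, one_mul]; exact h
    calc G.nu i = 1 * G.nu i := (one_mul _).symm
      _ ≤ (Real.sqrt ((n : ℝ) / 4))⁻¹ * (∑ e, G.wt i e) * G.nu i :=
          mul_le_mul_of_nonneg_right this (G.nu_nonneg i)
  rw [h1]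
  refine h2.trans (le_of_eq ?_)
  congr 1
  rw [Finset.sum_comm]
  rfl

end Gen

end AnalyticSeries

end Summit.Ventures.LatticeQCDFlow.TrivializingMaps

end
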